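import Summits.Ventures.DiscreteObjects.Hadamard.Order6Orbits

/-!
# Orbit normal form of the 6-cycles of a permutation with `π⁶ = 1` (6-cycles ⊔ everything else)

Framing: lottery ticket; floor = certified bounds/negative ranges.

Cell pub-namedobj (venture DiscreteObjects), target (H), hadamard gen 14; combinatorial input of the TYPE-I case of the
order-6 analysis (`Order6TypeI`).  For a permutation `π` of a finite linearly ordered type with `π⁶ = 1` (pointwise) a point
`i` lies on a `6`-cycle iff `π² i ≠ i ∧ π³ i ≠ i`; with `R₆ = {c | c on a 6-cycle, c = min of its orbit}` (minimality as
`∀ p : Fin 6, c ≤ π^p c`) the map `(p, c) ↦ π^p c` on `Fin 6 × R₆` together with the inclusion of the complement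
`{i | ¬(i on a 6-cycle)}` is a bijection onto `ι` (**`perm6C_bijective`**); hence `#{6-cycle points} = 6 · |R₆|`
(`perm6C_card_six`).  Companion of `perm62_bijective` (which assumed `π³` fixed-point-free).  Elementary; ours; no `sorry`.
-/

namespace Summit.Ventures.DiscreteObjects.Hadamard

open Finset

section orbit6C
variable {ι : Type*} (π : Equiv.Perm ι)

/-- being on a `6`-cycle is `π`-invariant -/
theorem six_cycle_invariant (i : ι) :
    (π (π (π i)) ≠ π i ∧ π (π (π (π i))) ≠ π i) ↔ (π (π i) ≠ i ∧ π (π (π i)) ≠ i) := by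
  constructor
  · rintro ⟨h2, h3⟩
    exact ⟨fun h => h2 (by rw [h]), fun h => h3 (by rw [h])⟩
  · rintro ⟨h2, h3⟩
    exact ⟨fun h => h2 (π.injective h), fun h => h3 (π.injective h)⟩

variable [LinearOrder ι] [Fintype ι]

/-- **Orbit normal form of the 6-cycles** of a permutation with `π⁶ = 1`: `(p, c) ↦ π^p c` on `Fin 6 × R₆` (orbit minima of
the `6`-cycles) together with the inclusion of the non-6-cycle points is a bijection onto `ι`. -/
theorem perm6C_bijective (hπ6 : ∀ i, π (π (π (π (π (π i))))) = i) :
    Function.Bijective (Sum.elim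
      (fun x : Fin 6 × {c // c ∈ univ.filter (fun c => (π (π c) ≠ c ∧ π (π (π c)) ≠ c) ∧
          ∀ p : Fin 6, c ≤ (π ^ (p : ℕ)) c)} => (π ^ (x.1 : ℕ)) x.2.1)
      (fun x : {i // i ∈ univ.filter (fun i => ¬ (π (π i) ≠ i ∧ π (π (π i)) ≠ i))} => x.1)) := by
  -- the orbit minimum
  have hO : ∀ i, ∃ m, (∃ p : Fin 6, m = (π ^ (p : ℕ)) i) ∧ ∀ p : Fin 6, m ≤ (π ^ (p : ℕ)) i := by
    intro i
    have hne : (univ.image (fun p : Fin 6 => (π ^ (p : ℕ)) i)).Nonempty :=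
      ⟨i, mem_image.mpr ⟨0, mem_univ _, by simp⟩⟩
    refine ⟨(univ.image (fun p : Fin 6 => (π ^ (p : ℕ)) i)).min' hne, ?_, ?_⟩
    · obtain ⟨p, -, hp⟩ := mem_image.mp ((univ.image (fun p : Fin 6 => (π ^ (p : ℕ)) i)).min'_mem hne)
      exact ⟨p, hp.symm⟩
    · intro p
      exact Finset.min'_le _ _ (mem_image.mpr ⟨p, mem_univ _, rfl⟩)
  choose M hMmem hMle using hO
  -- wrap-around
  have W1 : ∀ (p : Fin 6) (i : ι), ∃ p' : Fin 6, (π ^ (p : ℕ)) (π i) = (π ^ (p' : ℕ)) i := by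
    intro p i
    fin_cases p
    · exact ⟨1, by simp⟩
    · exact ⟨2, by simp [pow_succ]⟩
    · exact ⟨3, by simp [pow_succ]⟩
    · exact ⟨4, by simp [pow_succ]⟩
    · exact ⟨5, by simp [pow_succ]⟩
    · exact ⟨0, by simp [pow_succ, hπ6]⟩
  have W2 : ∀ (p : Fin 6) (i : ι), ∃ p' : Fin 6, (π ^ (p : ℕ)) i = (π ^ (p' : ℕ)) (π i) := by
    intro p i
    fin_cases p
    · exact ⟨5, by simp [pow_succ, hπ6]⟩
    · exact ⟨0, by simp⟩
    · exact ⟨1, by simp [pow_succ]⟩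
    · exact ⟨2, by simp [pow_succ]⟩
    · exact ⟨3, by simp [pow_succ]⟩
    · exact ⟨4, by simp [pow_succ]⟩
  have hMπ : ∀ i, M (π i) = M i := by
    intro i
    apply le_antisymm
    · obtain ⟨p, hp⟩ := hMmem i
      obtain ⟨p', hp'⟩ := W2 p i
      rw [hp, hp']
      exact hMle (π i) p'
    · obtain ⟨p, hp⟩ := hMmem (π i)
      obtain ⟨p', hp'⟩ := W1 p i
      rw [hp, hp']
      exact hMle i p'
  have hMpow : ∀ (n : ℕ) (i : ι), M ((π ^ n) i) = M i := by
    intro n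
    induction n with
    | zero => intro i; simp
    | succ n ih => intro i; rw [pow_succ', Equiv.Perm.mul_apply, hMπ, ih]
  have hMfix : ∀ i, M (M i) = M i := by
    intro i
    obtain ⟨p, hp⟩ := hMmem i
    have e := hMpow p i
    rw [← hp] at e
    exact e
  have hrep : ∀ c, (∀ p : Fin 6, c ≤ (π ^ (p : ℕ)) c) ↔ M c = c := by
    intro c
    constructor
    · intro h
      apply le_antisymm
      · simpa using hMle c 0
      · obtain ⟨p, hp⟩ := hMmem c
        rw [hp]
        exact h p
    · intro h p
      have e := hMle c p
      rwa [h] at e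
  have hMrep : ∀ i, ∀ p : Fin 6, M i ≤ (π ^ (p : ℕ)) (M i) := fun i => (hrep (M i)).mpr (hMfix i)
  -- being on a 6-cycle is invariant along the orbit
  have hsixpow : ∀ (n : ℕ) (i : ι),
      (π (π ((π ^ n) i)) ≠ (π ^ n) i ∧ π (π (π ((π ^ n) i))) ≠ (π ^ n) i) ↔ (π (π i) ≠ i ∧ π (π (π i)) ≠ i) := by
    intro n
    induction n with
    | zero => intro i; simp
    | succ n ih => intro i; rw [pow_succ', Equiv.Perm.mul_apply, six_cycle_invariant, ih]
  constructor
  · rintro (⟨p, c, hc⟩ | ⟨i, hi⟩) (⟨p', c', hc'⟩ | ⟨i', hi'⟩) h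
    · -- 6-cycle / 6-cycle
      simp only [Sum.elim_inl] at h
      have hcR := (mem_filter.mp hc).2
      have hc'R := (mem_filter.mp hc').2
      have hcc : c = c' := by
        have e1 := hMpow p c
        have e2 := hMpow p' c'
        rw [h] at e1
        rw [e1, (hrep c).mp hcR.2, (hrep c').mp hc'R.2] at e2
        exact e2
      subst hcc
      have h1c : π c ≠ c := fun h1 => hcR.1.1 (by rw [h1, h1])
      have hp : p = p' := perm6_pow_inj π hπ6 c h1c hcR.1.1 hcR.1.2 p p' h
      rw [hp]
    · -- 6-cycle / complement
      exfalso
      simp only [Sum.elim_inl, Sum.elim_inr] at h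
      have hcR := (mem_filter.mp hc).2
      have hi'R := (mem_filter.mp hi').2
      apply hi'R
      rw [← h]
      exact (hsixpow p c).mpr hcR.1
    · -- complement / 6-cycle
      exfalso
      simp only [Sum.elim_inl, Sum.elim_inr] at h
      have hiR := (mem_filter.mp hi).2
      have hc'R := (mem_filter.mp hc').2
      apply hiR
      rw [h]
      exact (hsixpow p' c').mpr hc'R.1
    · -- complement / complement
      simp only [Sum.elim_inr] at h
      subst h
      rfl
  · intro i
    by_cases hsix : π (π i) ≠ i ∧ π (π (π i)) ≠ i
    · obtain ⟨p, hp⟩ := hMmem i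
      obtain ⟨p', hp'⟩ : ∃ p' : Fin 6, i = (π ^ (p' : ℕ)) (M i) := by
        rw [hp]
        fin_cases p
        · exact ⟨0, by simp⟩
        · exact ⟨5, by simp [pow_succ, hπ6]⟩
        · exact ⟨4, by simp [pow_succ, hπ6]⟩
        · exact ⟨3, by simp [pow_succ, hπ6]⟩
        · exact ⟨2, by simp [pow_succ, hπ6]⟩
        · exact ⟨1, by simp [pow_succ, hπ6]⟩
      have hsixM : π (π (M i)) ≠ M i ∧ π (π (π (M i))) ≠ M i := by
        rw [hp]; exact (hsixpow p i).mpr hsix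
      have hmem : M i ∈ univ.filter (fun c => (π (π c) ≠ c ∧ π (π (π c)) ≠ c) ∧ ∀ p : Fin 6, c ≤ (π ^ (p : ℕ)) c) :=
        mem_filter.mpr ⟨mem_univ _, hsixM, hMrep i⟩
      exact ⟨Sum.inl (p', ⟨M i, hmem⟩), by simp only [Sum.elim_inl]; rw [← hp']⟩
    · have hmem : i ∈ univ.filter (fun i => ¬ (π (π i) ≠ i ∧ π (π (π i)) ≠ i)) :=
        mem_filter.mpr ⟨mem_univ _, hsix⟩
      exact ⟨Sum.inr ⟨i, hmem⟩, rfl⟩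

/-- the number of points on `6`-cycles is `6 · |R₆|` -/
theorem perm6C_card_six (hπ6 : ∀ i, π (π (π (π (π (π i))))) = i) :
    (univ.filter (fun i => π (π i) ≠ i ∧ π (π (π i)) ≠ i)).card =
      6 * (univ.filter (fun c => (π (π c) ≠ c ∧ π (π (π c)) ≠ c) ∧ ∀ p : Fin 6, c ≤ (π ^ (p : ℕ)) c)).card := by
  have hbij := perm6C_bijective π hπ6
  have h := Fintype.card_of_bijective hbij
  rw [Fintype.card_sum, Fintype.card_prod, Fintype.card_fin, Fintype.card_coe, Fintype.card_coe] at h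
  have hsplit := Finset.card_filter_add_card_filter_not (s := (univ : Finset ι))
    (fun i => π (π i) ≠ i ∧ π (π (π i)) ≠ i)
  rw [Finset.card_univ] at hsplit
  omega

end orbit6C

end Summit.Ventures.DiscreteObjects.Hadamard
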